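import Summits.QuantumFields.BalabanUV.T4Continuum.Support.AveragingDeficitPlaqLinBound


/-!
# AveragingDeficitCoreAxialPrep (T⁴ programme, node NE3, row NE3-R2) — preparation of THE PER-PLAQUETTE CORE ESTIMATE IN THE
# AXIAL GAUGE (file 1/2; file 2/2 `AveragingDeficitCoreAxial` assembles): region facts from the axial bound of B7 p. 24, (W) the
# coarse plaquette against the tree's flux linearisation, (M) the double stencil sum against its diagonal by covariant telescoping
# `|t_P + L^{2−d}·Σ_k Re tr((d_Vψ)(p_k)F(p_k))| ≤ c₁·SG·SF + c₂·a²·(Sψ + SG)` — layers (W) and (M) of the programme,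
# on top of (DL) (`AveragingDeficitPlaqLinBound`) and the tree's flux linearisation

HONEST FRAMING, CITATION HEADER, PLACEMENT: as in `AveragingDeficitDerivCore` (unit `b2b-balaban-t4-ne3r2-p1`, row NE3-R2;
β = `DeficitDerivWall` NOT proved here; [folklore] matrix bookkeeping on the tree's transcriptions; `[cite:]` tags are
CONTEXT; NE3 COND-free; finite-T⁴ rung (B)+1, not Clay).  The axial gauge condition enters as a HYPOTHESIS (`hbond`); the
gauge step that produces it for an arbitrary configuration (B7 (45), `axial_bond_bound`) is file `AveragingDeficitCoreGauge`.
WHAT IS PROVED.  §1 region facts from the axial bound; §2 (W): `V̄(∂P) − 1 = Θ_P + E`, `‖E‖ ≤ 325θ²`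
(`fluxLinearisation`, `expRem`); §3 (M): `Σ_{k,k'} Re tr(G_k F_{k'}) = L^{d+2}·Σ_k Re tr(G_kF_k) + ρ` by covariant
telescoping along `treeWord` (`pair_telescope`, `double_sum_telescope`); the assembly `core_axial` is file 2/2.  Record: `t4/T4-EST-NE3-R2.md`.
-/

set_option autoImplicit false

open scoped BigOperators Matrix Matrix.Norms.L2Operator Topology
open NormedSpace Finset Filter

namespace Summit.QuantumFields.BalabanUV.T4Continuum.AveragingDeficitCoreAxialPrep

open Literature.MathematicalPhysics.QuantumFieldTheory.Balaban1983to89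
open B7Prop1Explicit B7Prop2Explicit MatrixLog UnitaryModel
open T4AveragingDeficitWall hiding Site Plane Plaq Bond
open T4AveragingDeficitWallBoundary (stencilIdx stencilOff card_stencilIdx)
open T4AveragingDeficitNonAbelian (Ad_mul Ad_sub fluxAvg fluxLinearisation fluxAvg_eq_sum_idx)
open AveragingDeficitTransport AveragingDeficitLocality AveragingDeficitNearIdentity AveragingDeficitCounting
open AveragingDeficitSideDeriv AveragingDeficitPlaqDeriv AveragingDeficitDerivCore AveragingDeficitPlaqLin
open AveragingDeficitPlaqLinBound

noncomputable section

variable {d : ℕ} {n : Type*} [Fintype n] [DecidableEq n] [Nonempty n]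

local notation "𝕄" => Matrix n n ℂ
local notation "Site" => B7Prop1Explicit.Site
local notation "Plane" => T4AveragingDeficitWall.Plane
local notation "Plaq" => T4AveragingDeficitWall.Plaq

/-! ## §1 The region from the axial bound -/

/-- The `ℓ¹`/`ℓ^∞` radius of the per-plaquette box: covers `reach` and the telescoping paths of (M). [folklore] -/
def coreRad (d L : ℕ) : ℕ := (3 * d + 8) * L + 4

omit [Fintype n] [DecidableEq n] [Nonempty n] in
/-- `reach ≤ coreRad`, `3(d+2)L + 4 ≤ coreRad` (linear forms for `omega`). [folklore] -/
theorem coreRad_ge (d L : ℕ) : reach d L ≤ coreRad d L ∧ (d + 2) * L + 2 * ((d + 2) * L) ≤ coreRad d L := by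
  unfold reach coreRad; constructor <;> nlinarith

omit [Nonempty n] in
/-- **From the axial bound to a uniform region bound**: `‖V(b) − 1‖ ≤ |b₋ − y_c|₁·a` for all bonds and `|y_c − z|₁ = 2L`
give `RegionBound V z R ((R + 2L)·a)` for every `R`. [cite: Balaban1985Averaging, pp.24–25] -/
theorem regionBound_of_axial (L : ℕ) {V : Site d → Fin d → 𝕄ˣ} {z : Site d} {μ ν : Fin d} {a : ℝ} (ha : 0 ≤ a)
    (hbond : ∀ (x : Site d) (κ : Fin d),
      ‖((V x κ : 𝕄ˣ) : 𝕄) - 1‖ ≤ l1 (x - (z + (L : ℤ) • e μ + (L : ℤ) • e ν)) * a) (R : ℕ) :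
    RegionBound V z R ((R + 2 * L) * a) := by
  intro x κ hx
  refine (hbond x κ).trans (mul_le_mul_of_nonneg_right ?_ ha)
  have h1 := l1_add_le (x - z) (-((L : ℤ) • e μ + (L : ℤ) • e ν))
  rw [show x - z + -((L : ℤ) • e μ + (L : ℤ) • e ν) = x - (z + (L : ℤ) • e μ + (L : ℤ) • e ν) by abel, l1_neg] at h1
  have h2 := l1_add_le ((L : ℤ) • (e μ : Site d)) ((L : ℤ) • e ν)
  rw [l1_zsmul_e, l1_zsmul_e, Int.natAbs_natCast] at h2
  exact_mod_cast (h1.trans (by omega))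

omit [Fintype n] [DecidableEq n] [Nonempty n] in
/-- **The smallness of the region parameters** under `512(d+1)(d+4)L²a ≤ 1`: `(2d+2)L·(reach + 2L)·a ≤ 1/32`. [folklore] -/
theorem region_small (L : ℕ) (hL : 1 ≤ L) {a : ℝ} (ha : 0 ≤ a)
    (hsmall : 512 * (d + 1) * (d + 4) * (L : ℝ) ^ 2 * a ≤ 1) :
    (2 * d + 2) * L * (((reach d L : ℕ) + 2 * L) * a) ≤ 1 / 32 := by
  have hLr : (1 : ℝ) ≤ L := by exact_mod_cast hL
  have hdr : (0 : ℝ) ≤ d := Nat.cast_nonneg d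
  unfold reach
  push_cast
  -- `32(2d+2)L((2d+6)L + 4) ≤ 512(d+1)(d+4)L²` since `(2d+6)L + 4 ≤ 8(d+4)L`
  have key : 32 * ((2 * (d : ℝ) + 2) * L * (((2 * d + 4) * L + 4 + 2 * L))) ≤ 512 * (d + 1) * (d + 4) * (L : ℝ) ^ 2 := by
    nlinarith [mul_nonneg hdr (by linarith : (0 : ℝ) ≤ L), mul_nonneg (mul_nonneg hdr hdr) (by linarith : (0 : ℝ) ≤ L)]
  have := mul_le_mul_of_nonneg_right key ha
  nlinarith

/-! ## §2 (W): the Wilson weight against the flux linearisation -/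

omit [Nonempty n] in
/-- `‖e^F − 1 − F‖ ≤ ‖F‖²` for `‖F‖ ≤ 1`. [folklore] -/
theorem norm_exp_sub_one_sub_le_sq (F : 𝕄) (hF : ‖F‖ ≤ 1) : ‖exp F - 1 - F‖ ≤ ‖F‖ ^ 2 :=
  (norm_exp_sub_one_le_of_norm_le le_rfl).2.trans (expRem_le_sq (norm_nonneg _) hF)

omit [Nonempty n] in
/-- **(W) FOR THE COARSE PLAQUETTE**: in the axial gauge, `V̄(∂P) − 1 = Θ_P + E` with `‖E‖ ≤ 325θ²`, `‖Θ_P‖ ≤ 2L²a`,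
`θ = 8(d+1)(d+4)L²a` (the tree's `fluxLinearisation` + `e^F − 1 − F = O(F²)`). [cite: Balaban1985Averaging, (38) p.23, (47)–(50) p.25] -/
theorem coarse_minus_one_linearisation (L : ℕ) (hL : 1 ≤ L) (z : Site d) {μ ν : Fin d}
    (V : Site d → Fin d → 𝕄ˣ) {a : ℝ} (ha : 0 ≤ a) (hsmall : 512 * (d + 1) * (d + 4) * (L : ℝ) ^ 2 * a ≤ 1)
    (h44 : ∀ x, ‖((hol V x (plaqWord μ ν) : 𝕄ˣ) : 𝕄) - 1‖ ≤ a)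
    (hbond : ∀ (x : Site d) (κ : Fin d),
      ‖((V x κ : 𝕄ˣ) : 𝕄) - 1‖ ≤ l1 (x - (z + (L : ℤ) • e μ + (L : ℤ) • e ν)) * a) :
    ‖((cplaq L (bavg L V) z μ ν : 𝕄ˣ) : 𝕄) - 1 - fluxAvg L V z μ ν‖
        ≤ 325 * (8 * (d + 1) * (d + 4) * (L : ℝ) ^ 2 * a) ^ 2 ∧
      ‖fluxAvg L V z μ ν‖ ≤ 2 * (L : ℝ) ^ 2 * a := by
  obtain ⟨h1, h2, h3, h4⟩ := fluxLinearisation L hL z _ rfl V ha hsmall h44 (fun x κ _ => hbond x κ)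
  set θ := 8 * (d + 1) * (d + 4) * (L : ℝ) ^ 2 * a with hθ
  have hθ1 : θ ≤ 1 / 64 := by
    have : 64 * θ = 512 * (d + 1) * (d + 4) * (L : ℝ) ^ 2 * a := by rw [hθ]; ring
    linarith
  have hθ0 : 0 ≤ θ := by positivity
  set C : 𝕄 := ((cplaq L (bavg L V) z μ ν : 𝕄ˣ) : 𝕄) with hC
  have hC1 : ‖C - 1‖ < 1 := by linarith
  have hexp : exp (mlog C) = C := exp_mlog hC1
  have hF1 : ‖mlog C‖ ≤ 1 := by linarith
  refine ⟨?_, h2⟩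
  have e1 : C - 1 - fluxAvg L V z μ ν = (exp (mlog C) - 1 - mlog C) + (mlog C - fluxAvg L V z μ ν) := by
    rw [hexp]; abel
  rw [e1]
  calc _ ≤ ‖exp (mlog C) - 1 - mlog C‖ + ‖mlog C - fluxAvg L V z μ ν‖ := norm_add_le _ _
    _ ≤ ‖mlog C‖ ^ 2 + 300 * θ ^ 2 := add_le_add (norm_exp_sub_one_sub_le_sq _ hF1) h1
    _ ≤ (5 * θ) ^ 2 + 300 * θ ^ 2 := by gcongr
    _ = 325 * θ ^ 2 := by ring

/-! ## §3 (M): the double stencil sum against the diagonal -/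

omit [Nonempty n] in
/-- `‖F(p)‖ ≤ 2a` for the flux of a plaquette in the small-field class `a ≤ 1/4`. [folklore] -/
theorem norm_flux_le {V : Site d → Fin d → 𝕄ˣ} {a : ℝ} (ha1 : a ≤ 1 / 4) (p : Plaq d)
    (hp : ‖((fhol V p : 𝕄ˣ) : 𝕄) - 1‖ ≤ a) : ‖flux V p‖ ≤ 2 * a :=
  (norm_mlog_le_two_mul (hp.trans (by linarith))).trans (by linarith)

/-- **(M), one pair**: for stencil corners `x_k = z + off k`, `x_{k'} = z + off k'`,
`|Re tr(G_k F_{k'}) − Re tr(G_k F_k)| ≤ ‖G_k‖ · (2(d+2)L · SF + 2·(2(d+2)L·β′)·2a)`, where `SF = boxGradL1` over `box coreRad`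
and `β′` bounds the bonds there (covariant telescoping along `treeWord(off k' − off k)`). [folklore] -/
theorem pair_telescope (L : ℕ) {V : Site d → Fin d → 𝕄ˣ} (hV : IsUnitaryCfg V) (ψ : Site d → Fin d → 𝕄) (y : Site d)
    (π : Plane d) {a β' : ℝ} (ha1 : a ≤ 1 / 4) (hVa : SmallField V a)
    (hR' : RegionBound V ((L : ℤ) • y) (coreRad d L) β') {k k' : (Fin d → Fin L) × (ℕ × ℕ)}
    (hk : k ∈ stencilIdx d L) (hk' : k' ∈ stencilIdx d L) :
    |nReTr (curl V ψ (stencilPlaq L y π k) * flux V (stencilPlaq L y π k'))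
        - nReTr (curl V ψ (stencilPlaq L y π k) * flux V (stencilPlaq L y π k))|
      ≤ ‖curl V ψ (stencilPlaq L y π k)‖ * (2 * ((d + 2) * L) * boxGradL1 L V (coreRad d L) y π
          + 2 * (2 * ((d + 2) * L) * β') * (2 * a)) := by
  set z : Site d := (L : ℤ) • y with hz
  set xk : Site d := z + stencilOff L π.1.1 π.1.2 k with hxk
  set w : List (Letter d) := treeWord (stencilOff L π.1.1 π.1.2 k' - stencilOff L π.1.1 π.1.2 k) with hw
  set G := curl V ψ (stencilPlaq L y π k) with hG
  have hβ' : 0 ≤ β' := (norm_nonneg _).trans (hR' z π.1.1 (by simp [l1]))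
  have hdisp : xk + disp w = z + stencilOff L π.1.1 π.1.2 k' := by rw [hw, disp_treeWord, hxk]; abel
  have hoffk := l1_stencilOff_le L π.1.1 π.1.2 hk
  have hoffk' := l1_stencilOff_le L π.1.1 π.1.2 hk'
  have hlen : w.length ≤ 2 * ((d + 2) * L) := by
    rw [hw, length_treeWord]
    have := l1_add_le (stencilOff L π.1.1 π.1.2 k') (-stencilOff L π.1.1 π.1.2 k)
    rw [← sub_eq_add_neg, l1_neg] at this
    omega
  have hcr := (coreRad_ge d L).2
  -- every bond of the path starts within `ℓ¹`-distance `coreRad` of `z`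
  have hxz : l1 (xk - z) ≤ (d + 2) * L := by rw [hxk, add_sub_cancel_left]; exact hoffk
  have hbz : ∀ b ∈ bondsOf xk w, l1 (b.1 - z) ≤ coreRad d L := by
    intro b hb
    have h1 := l1_le_of_mem_bondsOf xk w b hb
    have h2 := l1_add_le (b.1 - xk) (xk - z)
    rw [show b.1 - xk + (xk - z) = b.1 - z by abel] at h2
    omega
  -- the telescoping sum against the box
  have htel := norm_Ad_hol_sub_le_sum_covGrad hV (flux V) π xk w
  rw [hdisp] at htel
  have hsum := sum_bondsOf_le_length_mul_sum (fun b : Site d × Fin d => ‖covGrad V (flux V) b.1 b.2 π‖)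
    (fun _ => norm_nonneg _) (box (coreRad d L) z ×ˢ (Finset.univ : Finset (Fin d))) xk w
    (fun b hb => Finset.mem_product.mpr ⟨mem_box_of_l1 (hbz b hb), Finset.mem_univ _⟩)
  have hBG : ∑ b ∈ box (coreRad d L) z ×ˢ (Finset.univ : Finset (Fin d)), ‖covGrad V (flux V) b.1 b.2 π‖
      = boxGradL1 L V (coreRad d L) y π := by
    unfold boxGradL1; rw [Finset.sum_product]
  rw [hBG] at hsum
  have hBG0 : 0 ≤ boxGradL1 L V (coreRad d L) y π := boxGradL1_nonneg L V _ y π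
  -- the transport defect
  have hhol : ‖((hol V xk w : 𝕄ˣ) : 𝕄) - 1‖ ≤ w.length * β' :=
    norm_hol_sub_one_le_of_bonds hV xk w fun b hb => hR' b.1 b.2 (hbz b hb)
  have hFk' : ‖flux V (z + stencilOff L π.1.1 π.1.2 k', π)‖ ≤ 2 * a :=
    norm_flux_le ha1 _ (hVa (z + stencilOff L π.1.1 π.1.2 k') π.1.1 π.1.2 (ne_of_lt π.2))
  have hAd : ‖Ad (hol V xk w) (flux V (z + stencilOff L π.1.1 π.1.2 k', π)) - flux V (z + stencilOff L π.1.1 π.1.2 k', π)‖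
      ≤ 2 * (2 * ((d + 2) * L) * β') * (2 * a) :=
    calc _ ≤ 2 * ‖((hol V xk w : 𝕄ˣ) : 𝕄) - 1‖ * ‖flux V (z + stencilOff L π.1.1 π.1.2 k', π)‖ :=
          norm_Ad_sub_le (hol_mem_of hV _ _) _
      _ ≤ 2 * (w.length * β') * (2 * a) :=
          mul_le_mul (mul_le_mul_of_nonneg_left hhol (by norm_num)) hFk' (norm_nonneg _) (by positivity)
      _ ≤ 2 * (2 * ((d + 2) * L) * β') * (2 * a) := by
          have : (w.length : ℝ) ≤ 2 * ((d + 2) * L) := by exact_mod_cast hlen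
          have ha0 : 0 ≤ a := by linarith [norm_nonneg (flux V (z + stencilOff L π.1.1 π.1.2 k', π)), hFk']
          have h1 : (w.length : ℝ) * β' ≤ 2 * ((d + 2) * L) * β' := mul_le_mul_of_nonneg_right this hβ'
          nlinarith [h1, ha0]
  -- assemble
  have hdiff : ‖flux V (z + stencilOff L π.1.1 π.1.2 k', π) - flux V (xk, π)‖
      ≤ 2 * ((d + 2) * L) * boxGradL1 L V (coreRad d L) y π + 2 * (2 * ((d + 2) * L) * β') * (2 * a) := by
    have hlen' : (w.length : ℝ) ≤ 2 * ((d + 2) * L) := by exact_mod_cast hlen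
    calc _ ≤ ‖flux V (z + stencilOff L π.1.1 π.1.2 k', π) - Ad (hol V xk w) (flux V (z + stencilOff L π.1.1 π.1.2 k', π))‖
          + ‖Ad (hol V xk w) (flux V (z + stencilOff L π.1.1 π.1.2 k', π)) - flux V (xk, π)‖ :=
          norm_sub_le_norm_sub_add_norm_sub _ _ _
      _ ≤ 2 * (2 * ((d + 2) * L) * β') * (2 * a) + w.length * boxGradL1 L V (coreRad d L) y π := by
          rw [norm_sub_rev]; exact add_le_add hAd (htel.trans hsum)
      _ ≤ _ := by nlinarith
  have hdiff' : ‖flux V (stencilPlaq L y π k') - flux V (stencilPlaq L y π k)‖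
      ≤ 2 * ((d + 2) * L) * boxGradL1 L V (coreRad d L) y π + 2 * (2 * ((d + 2) * L) * β') * (2 * a) := hdiff
  have e1 : nReTr (G * flux V (stencilPlaq L y π k')) - nReTr (G * flux V (stencilPlaq L y π k))
      = nReTr (G * (flux V (stencilPlaq L y π k') - flux V (stencilPlaq L y π k))) := by
    rw [mul_sub, ← nReTrL_apply, ← nReTrL_apply, ← nReTrL_apply, map_sub]
  rw [e1]
  exact (abs_nReTr_mul_le _ _).trans (mul_le_mul_of_nonneg_left hdiff' (norm_nonneg _))

/-- The diagonal versus the full double sum over the stencil. [folklore] -/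
theorem double_sum_telescope (L : ℕ) {V : Site d → Fin d → 𝕄ˣ} (hV : IsUnitaryCfg V) (ψ : Site d → Fin d → 𝕄)
    (y : Site d) (π : Plane d) {a β' : ℝ} (ha1 : a ≤ 1 / 4) (hVa : SmallField V a)
    (hR' : RegionBound V ((L : ℤ) • y) (coreRad d L) β') :
    |∑ k ∈ stencilIdx d L, ∑ k' ∈ stencilIdx d L,
        nReTr (curl V ψ (stencilPlaq L y π k) * flux V (stencilPlaq L y π k'))
      - (L : ℝ) ^ (d + 2) * stencilPair L V ψ y π|
      ≤ (L : ℝ) ^ (d + 2) * (2 * ((d + 2) * L) * boxGradL1 L V (coreRad d L) y π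
          + 2 * (2 * ((d + 2) * L) * β') * (2 * a)) * stencilCurlL1 L V ψ y π := by
  unfold stencilPair stencilCurlL1
  have hcard : ((stencilIdx d L).card : ℝ) = (L : ℝ) ^ (d + 2) := by rw [card_stencilIdx]; push_cast; ring
  have e1 : (L : ℝ) ^ (d + 2) * ∑ k ∈ stencilIdx d L, nReTr (curl V ψ (stencilPlaq L y π k) * flux V (stencilPlaq L y π k))
      = ∑ k ∈ stencilIdx d L, ∑ _k' ∈ stencilIdx d L,
          nReTr (curl V ψ (stencilPlaq L y π k) * flux V (stencilPlaq L y π k)) := by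
    rw [Finset.mul_sum]
    refine Finset.sum_congr rfl fun k _ => ?_
    rw [Finset.sum_const, nsmul_eq_mul, hcard]
  rw [e1, ← Finset.sum_sub_distrib]
  refine (Finset.abs_sum_le_sum_abs _ _).trans ?_
  rw [Finset.mul_sum]
  refine Finset.sum_le_sum fun k hk => ?_
  rw [← Finset.sum_sub_distrib]
  refine (Finset.abs_sum_le_sum_abs _ _).trans ?_
  calc _ ≤ ∑ _k' ∈ stencilIdx d L, ‖curl V ψ (stencilPlaq L y π k)‖ * (2 * ((d + 2) * L) * boxGradL1 L V (coreRad d L) y π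
          + 2 * (2 * ((d + 2) * L) * β') * (2 * a)) :=
        Finset.sum_le_sum fun k' hk' => pair_telescope L hV ψ y π ha1 hVa hR' hk hk'
    _ = _ := by rw [Finset.sum_const, nsmul_eq_mul, hcard]; ring

end

end Summit.QuantumFields.BalabanUV.T4Continuum.AveragingDeficitCoreAxialPrep
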